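import Mathlib
import Summits.Ventures.PercRepro2.Defs
import Summits.Ventures.PercRepro2.CoinKStarLattice
import Summits.Ventures.PercRepro2.CoinStarAlg

/-!
# The black-box head over a LOG-SUPERMODULAR core law (blind cell PercRepro2, night-2 g7;
proofs/NIGHT2-DARC.md §30.10)

`starCore_functional_nonneg` (CoinStarAlg.lean) treats a product core law split on the tail coin.
The same two-cell argument works for ANY nonnegative log-supermodular weight `ν` on the powerset of
the core `C` (e.g. the forward-cluster law of an out-tree from the root), with the split on
`u ∈ W` taken INSIDE the sums: the three weights are `μ₀ = ν·1[u ∉ ·]·A(·)`,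
`μ₁ = ν·1[u ∈ ·]·A(·)` and `μ' = ν·1[u ∈ ·]·A(· ∪ w)`; `μ₀, μ'` are log-supermodular (FKG), and
`μ₁` Holley-dominates `μ₀`, `μ'` dominates `μ₁` and `μ₀` (the indicator of `u` and the
log-supermodular `A` at shifted sets), so `star_alg` with `q = r = 1` closes.
-/

namespace Summit.Ventures.PercRepro2.Coin

section LsmCore

open Classical

variable {V : Type*} [Fintype V] [DecidableEq V] {R : Type*} [Field R] [LinearOrder R]
  [IsStrictOrderedRing R]

/-- The indicator of `u ∈ W` as a weight. -/
noncomputable def memWt (u : V) (W : Finset V) : R := if u ∈ W then 1 else 0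

/-- The indicator of `u ∉ W` as a weight. -/
noncomputable def notMemWt (u : V) (W : Finset V) : R := if u ∈ W then 0 else 1

omit [Fintype V] in
/-- `1[u ∈ ·] ≥ 0`. -/
lemma memWt_nonneg (u : V) (W : Finset V) : (0 : R) ≤ memWt u W := by
  unfold memWt; split_ifs <;> norm_num

omit [Fintype V] in
/-- `1[u ∉ ·] ≥ 0`. -/
lemma notMemWt_nonneg (u : V) (W : Finset V) : (0 : R) ≤ notMemWt u W := by
  unfold notMemWt; split_ifs <;> norm_num

omit [Fintype V] [IsStrictOrderedRing R] in
/-- `1[u ∉ ·]` is log-supermodular (as is every down-set indicator). -/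
lemma notMemWt_mul_le (u : V) (W W' : Finset V) :
    notMemWt (R := R) u W * notMemWt u W' ≤ notMemWt u (W ∩ W') * notMemWt u (W ∪ W') := by
  unfold notMemWt
  by_cases h : u ∈ W <;> by_cases h' : u ∈ W' <;> simp [h, h']

omit [Fintype V] [IsStrictOrderedRing R] in
/-- `1[u ∈ ·]` is log-supermodular (as is every up-set indicator). -/
lemma memWt_mul_le (u : V) (W W' : Finset V) :
    memWt (R := R) u W * memWt u W' ≤ memWt u (W ∩ W') * memWt u (W ∪ W') := by
  unfold memWt
  by_cases h : u ∈ W <;> by_cases h' : u ∈ W' <;> simp [h, h']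

omit [Fintype V] in
/-- `1[u ∈ ·]` Holley-dominates `1[u ∉ ·]`. -/
lemma notMemWt_mul_memWt_le (u : V) (W W' : Finset V) :
    notMemWt (R := R) u W * memWt u W' ≤ notMemWt u (W ∩ W') * memWt u (W ∪ W') := by
  unfold notMemWt memWt
  by_cases h : u ∈ W <;> by_cases h' : u ∈ W' <;> simp [h, h']

/-- **The black-box head over a log-supermodular core law.**  `ν ≥ 0` log-supermodular on the
powerset of `C`, `A ≥ 0` log-supermodular on the subsets of `C ∪ {w}` (`w ∉ C`), `x, y ≥ 0`
increasing data, `u ∈ C`.  With `Λ = Σ ν A`, `F̄_a = Σ ν A x`, … (the `R`-quantities) and the gate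
quantities built from `A_u = A` off `u` and `A(· ∪ w)` on `u`, the cleared gate functional is
nonnegative provided the two cell masses `M₀ = Σ_{W ∌ u} ν A` and `M' = Σ_{W ∋ u} ν A(· ∪ w)` are
positive. -/
theorem lsmCore_functional_nonneg (C : Finset V) (u w : V) (hw : w ∉ C)
    (ν A x y : Finset V → R)
    (hν0 : ∀ W ⊆ C, 0 ≤ ν W)
    (hν : ∀ W W', W ⊆ C → W' ⊆ C → ν W * ν W' ≤ ν (W ∩ W') * ν (W ∪ W'))
    (hA0 : ∀ X ⊆ insert w C, 0 ≤ A X)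
    (hA : ∀ X Y, X ⊆ insert w C → Y ⊆ insert w C → A X * A Y ≤ A (X ∩ Y) * A (X ∪ Y))
    (hx0 : ∀ W ⊆ C, 0 ≤ x W) (hy0 : ∀ W ⊆ C, 0 ≤ y W)
    (hx : ∀ W W', W ⊆ W' → W' ⊆ C → x W ≤ x W') (hy : ∀ W W', W ⊆ W' → W' ⊆ C → y W ≤ y W')
    (hM₀ : 0 < ∑ W ∈ C.powerset, ν W * notMemWt u W * A W)
    (hM' : 0 < ∑ W ∈ C.powerset, ν W * memWt u W * A (insert w W)) :
    0 ≤ (∑ W ∈ C.powerset, ν W * A W) ^ 2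
          * (∑ W ∈ C.powerset, ν W * notMemWt u W * A W * (x W * y W)
            + ∑ W ∈ C.powerset, ν W * memWt u W * A (insert w W) * (x W * y W))
        - (∑ W ∈ C.powerset, ν W * A W) * (∑ W ∈ C.powerset, ν W * A W * x W)
          * (∑ W ∈ C.powerset, ν W * notMemWt u W * A W * y W
            + ∑ W ∈ C.powerset, ν W * memWt u W * A (insert w W) * y W)
        - (∑ W ∈ C.powerset, ν W * A W) * (∑ W ∈ C.powerset, ν W * A W * y W)
          * (∑ W ∈ C.powerset, ν W * notMemWt u W * A W * x W
            + ∑ W ∈ C.powerset, ν W * memWt u W * A (insert w W) * x W)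
        + (∑ W ∈ C.powerset, ν W * A W * x W) * (∑ W ∈ C.powerset, ν W * A W * y W)
          * (∑ W ∈ C.powerset, ν W * notMemWt u W * A W
            + ∑ W ∈ C.powerset, ν W * memWt u W * A (insert w W)) := by
  set μ₀ : Finset V → R := fun W => ν W * notMemWt u W * A W with hμ₀
  set μ₁ : Finset V → R := fun W => ν W * memWt u W * A W with hμ₁
  set μ' : Finset V → R := fun W => ν W * memWt u W * A (insert w W) with hμ'
  have hsub : ∀ W ⊆ C, W ⊆ insert w C := fun W hW => hW.trans (Finset.subset_insert _ _)
  have hsub' : ∀ W ⊆ C, insert w W ⊆ insert w C := fun W hW => Finset.insert_subset_insert w hW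
  have hμ₀0 : ∀ W ⊆ C, 0 ≤ μ₀ W := fun W hW =>
    mul_nonneg (mul_nonneg (hν0 W hW) (notMemWt_nonneg u W)) (hA0 W (hsub W hW))
  have hμ₁0 : ∀ W ⊆ C, 0 ≤ μ₁ W := fun W hW =>
    mul_nonneg (mul_nonneg (hν0 W hW) (memWt_nonneg u W)) (hA0 W (hsub W hW))
  have hμ'0 : ∀ W ⊆ C, 0 ≤ μ' W := fun W hW =>
    mul_nonneg (mul_nonneg (hν0 W hW) (memWt_nonneg u W)) (hA0 _ (hsub' W hW))
  -- the `R`-sums split on `u`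
  have hsplit : ∀ g : Finset V → R, ∑ W ∈ C.powerset, ν W * A W * g W =
      ∑ W ∈ C.powerset, μ₀ W * g W + ∑ W ∈ C.powerset, μ₁ W * g W := by
    intro g
    rw [← Finset.sum_add_distrib]
    refine Finset.sum_congr rfl fun W _ => ?_
    simp only [hμ₀, hμ₁, notMemWt, memWt]
    split_ifs <;> ring
  have hsplit1 : ∑ W ∈ C.powerset, ν W * A W =
      ∑ W ∈ C.powerset, μ₀ W + ∑ W ∈ C.powerset, μ₁ W := by
    have := hsplit (fun _ => 1)
    simpa only [mul_one] using this
  -- set identities with `w ∉ C`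
  have hiw : ∀ W W' : Finset V, W ⊆ C → W ∩ insert w W' = W ∩ W' := by
    intro W W' hW
    exact Finset.inter_insert_of_notMem (fun h => hw (hW h))
  have huw : ∀ W W' : Finset V, W ∪ insert w W' = insert w (W ∪ W') := fun W W' =>
    Finset.union_insert w W W'
  have hiww : ∀ W W' : Finset V, insert w W ∩ insert w W' = insert w (W ∩ W') := by
    intro W W'; ext z; simp only [Finset.mem_inter, Finset.mem_insert]; tauto
  have huww : ∀ W W' : Finset V, insert w W ∪ insert w W' = insert w (W ∪ W') := by
    intro W W'; ext z; simp only [Finset.mem_union, Finset.mem_insert]; tauto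
  -- the product step for the weights
  have hstep : ∀ (i i' : Finset V → R) (f g : Finset V → Finset V) (W W' : Finset V),
      W ⊆ C → W' ⊆ C → f W ⊆ insert w C → g W' ⊆ insert w C →
      f W ∩ g W' = f (W ∩ W') → f W ∪ g W' = g (W ∪ W') →
      i W * i' W' ≤ i (W ∩ W') * i' (W ∪ W') → 0 ≤ i W → 0 ≤ i' W' →
      0 ≤ i (W ∩ W') → 0 ≤ i' (W ∪ W') →
      ν W * i W * A (f W) * (ν W' * i' W' * A (g W')) ≤
        ν (W ∩ W') * i (W ∩ W') * A (f (W ∩ W')) * (ν (W ∪ W') * i' (W ∪ W') * A (g (W ∪ W'))) := by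
    intro i i' f g W W' hW hW' hf hg hi hun hii hi0 hi'0 hi1 hi'1
    have h1 := hν W W' hW hW'
    have h2 := hA (f W) (g W') hf hg
    rw [hi, hun] at h2
    calc ν W * i W * A (f W) * (ν W' * i' W' * A (g W'))
        = (ν W * ν W') * (i W * i' W') * (A (f W) * A (g W')) := by ring
      _ ≤ (ν (W ∩ W') * ν (W ∪ W')) * (i (W ∩ W') * i' (W ∪ W')) *
          (A (f (W ∩ W')) * A (g (W ∪ W'))) := by
          apply mul_le_mul
          · apply mul_le_mul h1 hii (mul_nonneg hi0 hi'0)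
            exact mul_nonneg (hν0 _ (Finset.inter_subset_left.trans hW))
              (hν0 _ (Finset.union_subset hW hW'))
          · exact h2
          · exact mul_nonneg (hA0 _ hf) (hA0 _ hg)
          · exact mul_nonneg (mul_nonneg (hν0 _ (Finset.inter_subset_left.trans hW))
              (hν0 _ (Finset.union_subset hW hW'))) (mul_nonneg hi1 hi'1)
      _ = _ := by ring
  -- FKG for `μ₀` and `μ'`
  have hF₀ : (∑ W ∈ C.powerset, μ₀ W * x W) * ∑ W ∈ C.powerset, μ₀ W * y W ≤
      (∑ W ∈ C.powerset, μ₀ W) * ∑ W ∈ C.powerset, μ₀ W * (x W * y W) := by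
    apply fkg_powerset C μ₀ x y hμ₀0 hx0 hy0 hx hy
    intro W W' hW hW'
    exact hstep (notMemWt u) (notMemWt u) id id W W' hW hW' (hsub W hW) (hsub W' hW') rfl rfl
      (notMemWt_mul_le u W W') (notMemWt_nonneg u W) (notMemWt_nonneg u W')
      (notMemWt_nonneg u _) (notMemWt_nonneg u _)
  have hF' : (∑ W ∈ C.powerset, μ' W * x W) * ∑ W ∈ C.powerset, μ' W * y W ≤
      (∑ W ∈ C.powerset, μ' W) * ∑ W ∈ C.powerset, μ' W * (x W * y W) := by
    apply fkg_powerset C μ' x y hμ'0 hx0 hy0 hx hy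
    intro W W' hW hW'
    exact hstep (memWt u) (memWt u) (fun W => insert w W) (fun W => insert w W) W W' hW hW'
      (hsub' W hW) (hsub' W' hW') (hiww W W') (huww W W') (memWt_mul_le u W W')
      (memWt_nonneg u W) (memWt_nonneg u W') (memWt_nonneg u _) (memWt_nonneg u _)
  -- Holley `μ₀ → μ₁`, `μ₁ → μ'`, `μ₀ → μ'`
  have hH01 : ∀ z : Finset V → R, (∀ W ⊆ C, 0 ≤ z W) → (∀ W W', W ⊆ W' → W' ⊆ C → z W ≤ z W') →
      (∑ W ∈ C.powerset, μ₀ W * z W) * ∑ W ∈ C.powerset, μ₁ W ≤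
        (∑ W ∈ C.powerset, μ₀ W) * ∑ W ∈ C.powerset, μ₁ W * z W := by
    intro z hz0 hz
    apply holley_powerset C μ₀ μ₁ z hμ₀0 hμ₁0 hz0 hz
    intro W W' hW hW'
    exact hstep (notMemWt u) (memWt u) id id W W' hW hW' (hsub W hW) (hsub W' hW') rfl rfl
      (notMemWt_mul_memWt_le u W W') (notMemWt_nonneg u W) (memWt_nonneg u W')
      (notMemWt_nonneg u _) (memWt_nonneg u _)
  have hH1' : ∀ z : Finset V → R, (∀ W ⊆ C, 0 ≤ z W) → (∀ W W', W ⊆ W' → W' ⊆ C → z W ≤ z W') →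
      (∑ W ∈ C.powerset, μ₁ W * z W) * ∑ W ∈ C.powerset, μ' W ≤
        (∑ W ∈ C.powerset, μ₁ W) * ∑ W ∈ C.powerset, μ' W * z W := by
    intro z hz0 hz
    apply holley_powerset C μ₁ μ' z hμ₁0 hμ'0 hz0 hz
    intro W W' hW hW'
    exact hstep (memWt u) (memWt u) id (fun W => insert w W) W W' hW hW' (hsub W hW)
      (hsub' W' hW') (hiw W W' hW) (huw W W') (memWt_mul_le u W W') (memWt_nonneg u W)
      (memWt_nonneg u W') (memWt_nonneg u _) (memWt_nonneg u _)
  have hH0' : ∀ z : Finset V → R, (∀ W ⊆ C, 0 ≤ z W) → (∀ W W', W ⊆ W' → W' ⊆ C → z W ≤ z W') →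
      (∑ W ∈ C.powerset, μ₀ W * z W) * ∑ W ∈ C.powerset, μ' W ≤
        (∑ W ∈ C.powerset, μ₀ W) * ∑ W ∈ C.powerset, μ' W * z W := by
    intro z hz0 hz
    apply holley_powerset C μ₀ μ' z hμ₀0 hμ'0 hz0 hz
    intro W W' hW hW'
    exact hstep (notMemWt u) (memWt u) id (fun W => insert w W) W W' hW hW' (hsub W hW)
      (hsub' W' hW') (hiw W W' hW) (huw W W') (notMemWt_mul_memWt_le u W W')
      (notMemWt_nonneg u W) (memWt_nonneg u W') (notMemWt_nonneg u _) (memWt_nonneg u _)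
  have key := star_alg (1 : R) 1 (∑ W ∈ C.powerset, μ₀ W) (∑ W ∈ C.powerset, μ₀ W * x W)
    (∑ W ∈ C.powerset, μ₀ W * y W) (∑ W ∈ C.powerset, μ₀ W * (x W * y W))
    (∑ W ∈ C.powerset, μ₁ W) (∑ W ∈ C.powerset, μ₁ W * x W) (∑ W ∈ C.powerset, μ₁ W * y W)
    (∑ W ∈ C.powerset, μ' W) (∑ W ∈ C.powerset, μ' W * x W) (∑ W ∈ C.powerset, μ' W * y W)
    (∑ W ∈ C.powerset, μ' W * (x W * y W)) zero_le_one zero_le_one hM₀ hM' hF₀ hF'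
    (hH01 x hx0 hx) (hH01 y hy0 hy) (hH1' x hx0 hx) (hH1' y hy0 hy) (hH0' x hx0 hx) (hH0' y hy0 hy)
  simp only [one_mul] at key
  rw [hsplit1, hsplit x, hsplit y]
  exact key

end LsmCore

end Summit.Ventures.PercRepro2.Coin
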